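import Mathlib
import HarnessLib
import Summits.ABC.ABC.Theses.CongruentialReceptacle
import Summits.ABC.ABC.Theorems.CongruentialReceptacleCompactBalanceTransferWindowEngine

/-!
# Crux `CompactBalanceTransfer` (stmt-ABC-1725) — window transfer, part 3: DOWN (Claim A, shallow windows)

Support file (`--supports stmt-ABC-1725`) of the line lead `prover-line-stmt-ABC-1725-c8-0` (2026-08-17); see
`…CompactBalanceTransferWindowEngine` for the schema and notation (`h = log c`, `r = log rad(abc)`,
`m = log(c/min(a,b))`).

`abc_of_shallowWindow` (STRATEGY-CENSUS §3 S5, Claim A): for `0 < β ≤ 1`, `λ, K ≥ 0` with `λ·(1−β) < β`, abc with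
η-uniform constants `K·η^(−λ)` on the relatively SHALLOW window `{m ≤ h^β}` implies `ABC`. Mechanism
(`shallowWindow_core`): the power map on the LARGE member `(bᴺ, cᴺ − bᴺ, cᴺ)` multiplies the height by `N` while the
depth does not grow (`cᴺ − bᴺ ≥ a·c^(N−1)`), so at level `N = ⌈h^((1−β)/β)⌉` the window top `(Nh)^β ≥ h` exceeds every
depth; the level is capped at `⌊c/(2a)⌋` to keep `cᴺ − bᴺ` the small member (`2Na ≤ c`), and when the cap binds the
companion is compactly balanced outright (`cᴺ − bᴺ ≥ cᴺ/5` from `(b/c)ᴺ ≤ e^(−Na/c) ≤ e^(−1/4)`), depth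
`≤ log 5 ≤ h^β`. The engine absorbs toll, junk `log N` and constant `K(4N/ε)^λ ≍ h^(λ(1−β)/β)` exactly when
`λ(1−β) < β`.
READING FOR THE CRUX. The hypothesis `H` of `CompactBalanceTransfer` lives on the window `{m ≤ log(1/κ)}` — the corner
`β = 0` of this family, where `λ(1−β) < β` is void for every `λ ≥ 0`: even a QUANTITATIVE `H` with
Robert–Stewart–Tenenbaum constants (`λ ≈ 1`) is not moved by this transfer (census S2/O16: its reach is depth
`O(log log c)`), while `abc_of_shallowWindow_linearConstants` records that ANY window `{m ≤ h^β}` with `β > 1/2` and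
constants `e^(K/η)` already carries all of abc. So the typed route-level remedy for the archimedean partner is: state
the receptacle's Target on a window `{log(c/min) ≤ (log c)^β}`, `β > λ/(1+λ)`, with its constants' η-dependence
explicit — then the transfer is THIS theorem, not a crux. (An archimedean-blind mechanism with error `O(log⁺|j|) =
O(m)` on that window produces `λ = β/(1−β)` exactly — the borderline, census S5.3 — so the remedy needs the error term
to beat `O(m)` by any power of `h`.)
Unconditional; hypotheses spelled out (no `def`s); standard axioms; no named facts.
-/

-- `Summit.<Summit>.<Problem>`: for the single-conjunct summit `ABC` the duplicate `ABC.ABC` is mandated.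
set_option linter.dupNamespace false

namespace Summit.ABC.ABC.Theorems.CompactBalanceTransfer.WindowTransfer

open Literature.NumberTheory.DiophantineGeometry
open Summit.ABC.ABC.Theses.CongruentialReceptacle
open Summit.ABC.ABC.Theorems.CompactBalanceTransfer.PowerDeep
open Summit.ABC.ABC.Theorems.CompactBalanceTransfer.Negative

/-! ### Claim A (DOWN): a shallow window with polynomial constants carries all of abc -/

/-- `exp(−1/4) ≤ 4/5` (from `1 + 1/4 ≤ exp(1/4)`). [folklore] -/
theorem exp_neg_quarter_le : Real.exp (-(1 / 4 : ℝ)) ≤ 4 / 5 := by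
  have h1 : (1 / 4 : ℝ) + 1 ≤ Real.exp (1 / 4) := Real.add_one_le_exp _
  have e : Real.exp (-(1 / 4 : ℝ)) * Real.exp (1 / 4) = 1 := by rw [← Real.exp_add]; norm_num
  have hpos : 0 < Real.exp (-(1 / 4 : ℝ)) := Real.exp_pos _
  nlinarith [mul_le_mul_of_nonneg_left h1 hpos.le]

/-- The balanced branch of the DOWN move: if `c < 4n·a` then `(b/c)ⁿ ≤ e^(−n·a/c) ≤ e^(−1/4) ≤ 4/5`, i.e.
`bⁿ ≤ (4/5)·cⁿ`, so the companion `(bⁿ, cⁿ − bⁿ, cⁿ)` has `cⁿ − bⁿ ≥ cⁿ/5`. [folklore] -/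
theorem pow_large_member_le {a b c : ℕ} (h : IsABCTriple a b c) {n : ℕ}
    (h4 : (c : ℝ) < 4 * (n : ℝ) * a) : (b : ℝ) ^ n ≤ 4 / 5 * (c : ℝ) ^ n := by
  obtain ⟨ha, hb, hsum, _⟩ := h
  have haR : (0 : ℝ) < a := by exact_mod_cast ha
  have hbR : (0 : ℝ) < b := by exact_mod_cast hb
  have hcab : (c : ℝ) = a + b := by exact_mod_cast hsum.symm
  have hcR : (0 : ℝ) < c := by rw [hcab]; positivity
  obtain ⟨x, hxdef⟩ : ∃ x : ℝ, x = (a : ℝ) / c := ⟨_, rfl⟩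
  have hNx : 1 / 4 ≤ (n : ℝ) * x := by
    rw [hxdef, mul_div_assoc', le_div_iff₀ hcR]; linarith
  have hbx : (b : ℝ) = (1 - x) * c := by rw [hxdef, hcab]; field_simp; ring
  have h1x : 0 ≤ 1 - x := by
    rw [hxdef, sub_nonneg, div_le_one hcR, hcab]; linarith
  have hcn : (0 : ℝ) ≤ (c : ℝ) ^ n := pow_nonneg hcR.le _
  have hbpow : (b : ℝ) ^ n ≤ Real.exp (-((n : ℝ) * x)) * (c : ℝ) ^ n := by
    rw [hbx, mul_pow]
    apply mul_le_mul_of_nonneg_right _ hcn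
    calc (1 - x) ^ n ≤ (Real.exp (-x)) ^ n := pow_le_pow_left₀ h1x (Real.one_sub_le_exp_neg x) n
      _ = Real.exp (-((n : ℝ) * x)) := by rw [← Real.exp_nat_mul]; ring_nf
  have hexp : Real.exp (-((n : ℝ) * x)) ≤ 4 / 5 := by
    refine le_trans (Real.exp_le_exp.mpr ?_) exp_neg_quarter_le
    linarith
  exact le_trans hbpow (mul_le_mul_of_nonneg_right hexp hcn)

/-- **Core step of Claim A.** Under the shallow-window hypothesis with constants `K·η^(−λ)`, ANY triple with
`a ≤ b`, `log c ≥ 1` and `(log c)^β ≥ log 5` is pushed DOWN into the window `{log c − log min ≤ (log c)^β}` by the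
power map on the LARGE member `(bᴺ, cᴺ − bᴺ, cᴺ)` at level `N = min(⌈(log c)^((1−β)/β)⌉, ⌊c/(2a)⌋)`: the height
multiplies by `N` while the depth does not grow (`cᴺ − bᴺ ≥ a·cᴺ⁻¹`), so at `N = ⌈h^((1−β)/β)⌉` the window top
`(N·h)^β ≥ h` exceeds every depth; and if `⌊c/(2a)⌋` is the smaller level the companion is already compactly balanced
(`cᴺ − bᴺ ≥ cᴺ/5`, as `(b/c)ᴺ ≤ e^(−N·a/c) ≤ e^(−1/4)`), depth `≤ log 5 ≤ h^β`. Either way `2N·a ≤ c` keeps `cᴺ − bᴺ`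
the small member, the radical is `≤ N·cᴺ⁻¹·rad(abc)` (`rad_powMapMax_mul_le`, `powMapMax_sub_bounds`), and the
hypothesis at `η = ε/(4N)` yields the tolled window inequality at level `N ≤ 2·(log c)^((1−β)/β)`. [folklore] -/
theorem shallowWindow_core {β lam K ε : ℝ} (hβ : 0 < β) (hε : 0 < ε) (hε2 : ε ≤ 1 / 2)
    (hW : ∀ η : ℝ, 0 < η → η ≤ 1 → ∀ a b c : ℕ, IsABCTriple a b c →
      Real.log (c : ℝ) - Real.log ((min a b : ℕ) : ℝ) ≤ (Real.log (c : ℝ)) ^ β →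
        Real.log (c : ℝ) ≤ (1 + η) * Real.log ((rad a b c : ℕ) : ℝ) + K * η ^ (-lam))
    {a b c : ℕ} (h : IsABCTriple a b c) (hab : a ≤ b) (h1 : 1 ≤ Real.log (c : ℝ))
    (hβ1 : β ≤ 1) (h5 : Real.log 5 ≤ (Real.log (c : ℝ)) ^ β) :
    ∃ N : ℝ, 1 ≤ N ∧ N ≤ 2 * (Real.log (c : ℝ)) ^ ((1 - β) / β) ∧
      N * Real.log (c : ℝ) ≤ (1 + ε / (4 * N)) * (Real.log ((rad a b c : ℕ) : ℝ) + Real.log (2 * N) +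
        (N - 1) * Real.log (c : ℝ)) + K * (ε / (4 * N)) ^ (-lam) := by
  obtain ⟨ha, hb, hsum, hcop⟩ := h
  have habc : IsABCTriple a b c := ⟨ha, hb, hsum, hcop⟩
  have hc : 0 < c := by omega
  have hcR : (0 : ℝ) < c := by exact_mod_cast hc
  have haR : (0 : ℝ) < a := by exact_mod_cast ha
  have hbR : (0 : ℝ) < b := by exact_mod_cast hb
  have ha1 : (1 : ℝ) ≤ a := by exact_mod_cast ha
  have h2aR : 2 * (a : ℝ) ≤ c := by exact_mod_cast (show 2 * a ≤ c by omega)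
  have hcab : (c : ℝ) = a + b := by exact_mod_cast hsum.symm
  set hh : ℝ := Real.log (c : ℝ) with hhdef
  have hhpos : 0 < hh := lt_of_lt_of_le one_pos h1
  have hp0 : 0 ≤ (1 - β) / β := div_nonneg (by linarith) hβ.le
  -- the two candidate levels and `N = min N₁ N₂`
  have hpow1 : 1 ≤ hh ^ ((1 - β) / β) := Real.one_le_rpow h1 hp0
  set N₁ : ℕ := ⌈hh ^ ((1 - β) / β)⌉₊ with hN₁def
  have hN₁pos : 0 < N₁ := Nat.ceil_pos.mpr (lt_of_lt_of_le one_pos hpow1)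
  have hN₁ge : hh ^ ((1 - β) / β) ≤ (N₁ : ℝ) := Nat.le_ceil _
  have hN₁lt : (N₁ : ℝ) < hh ^ ((1 - β) / β) + 1 := Nat.ceil_lt_add_one (by linarith)
  set N₂ : ℕ := ⌊(c : ℝ) / (2 * a)⌋₊ with hN₂def
  have hq2 : 1 ≤ (c : ℝ) / (2 * a) := by rw [le_div_iff₀ (by positivity)]; linarith
  have hN₂pos : 0 < N₂ := Nat.floor_pos.mpr hq2
  have hN₂le : (N₂ : ℝ) ≤ (c : ℝ) / (2 * a) := Nat.floor_le (by positivity)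
  have hN₂gt : (c : ℝ) / (2 * a) < (N₂ : ℝ) + 1 := Nat.lt_floor_add_one _
  set Nn : ℕ := min N₁ N₂ with hNndef
  have hNnpos : 0 < Nn := lt_min hN₁pos hN₂pos
  have hNn0 : Nn ≠ 0 := hNnpos.ne'
  -- real-number data of the power map on the large member (obtained before naming `N := ↑Nn`)
  obtain ⟨hlow, hupp⟩ := powMapMax_sub_bounds habc hNn0
  have hradN := rad_powMapMax_mul_le habc hNn0
  have hT : IsABCTriple (b ^ Nn) (c ^ Nn - b ^ Nn) (c ^ Nn) := powMap_isABCTriple habc.swap hNn0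
  have hltN : b ^ Nn < c ^ Nn := Nat.pow_lt_pow_left (show b < c by omega) hNn0
  have hcastsub : ((c ^ Nn - b ^ Nn : ℕ) : ℝ) = (c : ℝ) ^ Nn - (b : ℝ) ^ Nn := by
    rw [Nat.cast_sub hltN.le]; push_cast; ring
  have hcastpred : ((Nn - 1 : ℕ) : ℝ) = (Nn : ℝ) - 1 := by
    rw [Nat.cast_sub (Nat.one_le_iff_ne_zero.mpr hNn0)]; push_cast; ring
  have hck : (c : ℝ) ^ Nn = c * (c : ℝ) ^ (Nn - 1) := by
    rw [← pow_succ']; congr 1; omega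
  have hlogcpred : Real.log ((c : ℝ) ^ (Nn - 1)) = ((Nn : ℝ) - 1) * hh := by
    rw [Real.log_pow, hcastpred]
  set N : ℝ := (Nn : ℝ) with hNdef
  have hN1 : (1 : ℝ) ≤ N := by rw [hNdef]; exact Nat.one_le_cast.mpr hNnpos
  have hNpos : (0 : ℝ) < N := by linarith
  have hNleN₁ : N ≤ (N₁ : ℝ) := by rw [hNdef]; exact_mod_cast min_le_left N₁ N₂
  have hNleN₂ : N ≤ (N₂ : ℝ) := by rw [hNdef]; exact_mod_cast min_le_right N₁ N₂
  have hNle : N ≤ 2 * hh ^ ((1 - β) / β) := by linarith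
  -- `2 N a ≤ c` and `c < 4 N a`
  have h2Na : 2 * N * (a : ℝ) ≤ c := by
    have h2 := le_trans hNleN₂ hN₂le
    rw [le_div_iff₀ (by positivity)] at h2; linarith
  -- positivity of the small member `D = cᴺ − bᴺ`
  set D : ℝ := (c : ℝ) ^ Nn - (b : ℝ) ^ Nn with hDdef
  have hcpredpos : (0 : ℝ) < (c : ℝ) ^ (Nn - 1) := pow_pos hcR _
  have hcNpos : (0 : ℝ) < (c : ℝ) ^ Nn := pow_pos hcR _
  have hDlow : (a : ℝ) * (c : ℝ) ^ (Nn - 1) ≤ D := hlow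
  have hDpos : 0 < D := lt_of_lt_of_le (mul_pos haR hcpredpos) hDlow
  -- the small member of the companion is `cᴺ − bᴺ` (as `2Na ≤ c`, Bernoulli)
  have hhalf : D ≤ (c : ℝ) ^ Nn / 2 := by
    have h2 : N * (a : ℝ) * (c : ℝ) ^ (Nn - 1) ≤ (c : ℝ) ^ Nn / 2 := by
      rw [hck]
      have := mul_le_mul_of_nonneg_right h2Na hcpredpos.le
      linarith
    exact le_trans hupp h2
  have hmin : min (b ^ Nn) (c ^ Nn - b ^ Nn) = c ^ Nn - b ^ Nn := by
    apply min_eq_right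
    have h2 : ((c ^ Nn - b ^ Nn : ℕ) : ℝ) ≤ ((b ^ Nn : ℕ) : ℝ) := by
      rw [hcastsub]; push_cast; linarith [hhalf]
    exact_mod_cast h2
  have hlogcN : Real.log ((c ^ Nn : ℕ) : ℝ) = N * hh := by
    push_cast; rw [Real.log_pow]
  have hlogmin : Real.log ((min (b ^ Nn) (c ^ Nn - b ^ Nn) : ℕ) : ℝ) = Real.log D := by
    rw [hmin, hcastsub]
  -- the companion lies in the shallow window
  have hwindow : Real.log ((c ^ Nn : ℕ) : ℝ) - Real.log ((min (b ^ Nn) (c ^ Nn - b ^ Nn) : ℕ) : ℝ) ≤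
      (Real.log ((c ^ Nn : ℕ) : ℝ)) ^ β := by
    rw [hlogmin, hlogcN]
    have hhN : hh ≤ N * hh := le_mul_of_one_le_left hhpos.le hN1
    have hmonoβ : hh ^ β ≤ (N * hh) ^ β := Real.rpow_le_rpow hhpos.le hhN hβ.le
    rcases le_total N₁ N₂ with h12 | h21
    · -- `N = N₁ ≥ h^((1-β)/β)`: depth does not grow, window top `(N h)^β ≥ h`
      have hNN₁ : N = (N₁ : ℝ) := by rw [hNdef, hNndef, min_eq_left h12]
      have hlogD : Real.log (a : ℝ) + (N - 1) * hh ≤ Real.log D := by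
        have h2 := Real.log_le_log (mul_pos haR hcpredpos) hDlow
        rw [Real.log_mul haR.ne' hcpredpos.ne', hlogcpred] at h2
        exact h2
      have hloga : 0 ≤ Real.log (a : ℝ) := Real.log_nonneg ha1
      have htop : hh ≤ (N * hh) ^ β := by
        have h3 : hh ^ ((1 - β) / β) * hh ≤ N * hh := by
          apply mul_le_mul_of_nonneg_right _ hhpos.le
          rw [hNN₁]; exact hN₁ge
        have h4 : hh ^ ((1 - β) / β) * hh = hh ^ (1 / β) := by
          rw [← Real.rpow_add_one hhpos.ne']
          congr 1; field_simp; ring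
        have h5' : (hh ^ (1 / β)) ^ β = hh := by
          rw [← Real.rpow_mul hhpos.le]
          have : 1 / β * β = 1 := by field_simp
          rw [this, Real.rpow_one]
        have h6 : (hh ^ (1 / β)) ^ β ≤ (N * hh) ^ β :=
          Real.rpow_le_rpow (Real.rpow_nonneg hhpos.le _) (by rw [← h4]; exact h3) hβ.le
        rw [h5'] at h6; exact h6
      linarith
    · -- `N = N₂ = ⌊c/(2a)⌋`: the companion is compactly balanced, depth `≤ log 5 ≤ h^β`
      have hNN₂ : N = (N₂ : ℝ) := by rw [hNdef, hNndef, min_eq_right h21]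
      have h4Na : (c : ℝ) < 4 * N * a := by
        have h2 : (c : ℝ) / (2 * a) < N + 1 := by rw [hNN₂]; exact hN₂gt
        rw [div_lt_iff₀ (by positivity)] at h2
        have h3 : 2 * (a : ℝ) * 1 ≤ 2 * a * N := mul_le_mul_of_nonneg_left hN1 (by positivity)
        linarith
      have hD5 : (c : ℝ) ^ Nn / 5 ≤ D := by
        have h2 := pow_large_member_le habc (n := Nn) (by rw [← hNdef]; exact h4Na)
        rw [hDdef]; linarith
      have hlogD : N * hh - Real.log 5 ≤ Real.log D := by
        have h2 := Real.log_le_log (by positivity) hD5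
        rw [Real.log_div hcNpos.ne' (by norm_num), Real.log_pow] at h2
        rw [hhdef]; linarith
      linarith
  -- apply the window hypothesis at `η = ε/(4N)`
  set η : ℝ := ε / (4 * N) with hηdef
  have hη : 0 < η := by positivity
  have hη1 : η ≤ 1 := by
    rw [hηdef, div_le_one (by positivity)]; linarith
  have hmain := hW η hη hη1 _ _ _ hT hwindow
  rw [hlogcN] at hmain
  -- radical of the companion: `log rad' ≤ log N + (N-1) h + r`
  have hr0 : (0 : ℝ) < ((rad a b c : ℕ) : ℝ) := by exact_mod_cast rad_pos_nat a b c
  have hr'0 : (0 : ℝ) < ((rad (b ^ Nn) (c ^ Nn - b ^ Nn) (c ^ Nn) : ℕ) : ℝ) := by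
    exact_mod_cast rad_pos_nat _ _ _
  have hRR : ((rad (b ^ Nn) (c ^ Nn - b ^ Nn) (c ^ Nn) : ℕ) : ℝ) * a ≤ D * ((rad a b c : ℕ) : ℝ) := by
    have h2 : ((rad (b ^ Nn) (c ^ Nn - b ^ Nn) (c ^ Nn) * a : ℕ) : ℝ) ≤
        (((c ^ Nn - b ^ Nn) * rad a b c : ℕ) : ℝ) := by exact_mod_cast hradN
    push_cast at h2
    rw [hcastsub] at h2
    exact h2
  have hrad' : ((rad (b ^ Nn) (c ^ Nn - b ^ Nn) (c ^ Nn) : ℕ) : ℝ) ≤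
      N * (c : ℝ) ^ (Nn - 1) * ((rad a b c : ℕ) : ℝ) := by
    have h2 : D * ((rad a b c : ℕ) : ℝ) ≤ N * (a : ℝ) * (c : ℝ) ^ (Nn - 1) * ((rad a b c : ℕ) : ℝ) :=
      mul_le_mul_of_nonneg_right hupp hr0.le
    have h3 := le_trans hRR h2
    have e : N * (a : ℝ) * (c : ℝ) ^ (Nn - 1) * ((rad a b c : ℕ) : ℝ) =
        (N * (c : ℝ) ^ (Nn - 1) * ((rad a b c : ℕ) : ℝ)) * a := by ring
    rw [e] at h3
    exact le_of_mul_le_mul_right h3 haR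
  have hlogr' : Real.log ((rad (b ^ Nn) (c ^ Nn - b ^ Nn) (c ^ Nn) : ℕ) : ℝ) ≤
      Real.log N + (N - 1) * hh + Real.log ((rad a b c : ℕ) : ℝ) := by
    have h2 := Real.log_le_log hr'0 hrad'
    rw [Real.log_mul (by positivity) hr0.ne', Real.log_mul hNpos.ne' hcpredpos.ne', hlogcpred] at h2
    exact h2
  have hlogN2 : Real.log N ≤ Real.log (2 * N) := Real.log_le_log hNpos (by linarith)
  refine ⟨N, hN1, hNle, ?_⟩
  have h1η : 0 ≤ 1 + η := by linarith
  have h2 : (1 + η) * Real.log ((rad (b ^ Nn) (c ^ Nn - b ^ Nn) (c ^ Nn) : ℕ) : ℝ) ≤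
      (1 + η) * (Real.log ((rad a b c : ℕ) : ℝ) + Real.log (2 * N) + (N - 1) * hh) := by
    apply mul_le_mul_of_nonneg_left _ h1η; linarith
  linarith [hmain, h2]


/-- **Claim A (window transfer DOWN; STRATEGY-CENSUS §3 S5).** Let `0 < β ≤ 1`, `λ ≥ 0`, `K ≥ 0` with
`λ·(1 − β) < β` (i.e. `λ < β/(1−β)`). If abc holds with η-UNIFORM POLYNOMIAL CONSTANTS on the relatively SHALLOW
window `{log(c/min(a,b)) ≤ (log c)^β}` — for every `η ∈ (0,1]` and every abc-triple in the window,
`log c ≤ (1+η)·log rad(abc) + K·η^(−λ)` — then the abc conjecture holds for ALL triples. Mechanism: the power map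
on the large member (`shallowWindow_core`) at level `N ≤ 2(log c)^((1−β)/β)`; the toll is paid at `η = ε/(4N)` and
the constant `K(4N/ε)^λ ≍ (log c)^(λ(1−β)/β)` is `o(log c)` exactly when `λ(1−β) < β` (`height_le_of_tolled_window`).
READING FOR THE CRUX: the compactly balanced cell of `H` (`log(c/min) ≤ log(1/κ)`) is the degenerate corner `β = 0`
of this family, where the condition `λ < β/(1−β)` is void — `H`, even with Robert–Stewart–Tenenbaum-type constants
`λ ≈ 1`, is the one shallow window from which this transfer does not run; any window growing like `(log c)^β` with
`β > λ/(1+λ)` (e.g. `β > 1/2` for `λ = 1`) makes the archimedean transfer a theorem. [folklore] -/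
theorem abc_of_shallowWindow {β lam K : ℝ} (hβ : 0 < β) (hβ1 : β ≤ 1) (hlam : 0 ≤ lam) (hK : 0 ≤ K)
    (hβl : lam * (1 - β) < β)
    (hW : ∀ η : ℝ, 0 < η → η ≤ 1 → ∀ a b c : ℕ, IsABCTriple a b c →
      Real.log (c : ℝ) - Real.log ((min a b : ℕ) : ℝ) ≤ (Real.log (c : ℝ)) ^ β →
        Real.log (c : ℝ) ≤ (1 + η) * Real.log ((rad a b c : ℕ) : ℝ) + K * η ^ (-lam)) :
    _root_.ABC := by
  rw [ABC_iff]
  intro ε₀ hε₀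
  set ε : ℝ := min ε₀ (1 / 2) with hεdef
  have hε : 0 < ε := lt_min hε₀ (by norm_num)
  have hε2 : ε ≤ 1 / 2 := min_le_right _ _
  have hεle : ε ≤ ε₀ := min_le_left _ _
  set p : ℝ := (1 - β) / β with hpdef
  have hp : 0 ≤ p := div_nonneg (by linarith) hβ.le
  have hpl : p * lam < 1 := by
    rw [hpdef, div_mul_eq_mul_div, div_lt_one hβ]; linarith
  obtain ⟨K₂, hK₂⟩ := height_le_of_tolled_window hε hε2 hK hlam hp hpl (by norm_num : (0 : ℝ) < 2)
  -- height threshold `h₀`: `h ≥ h₀` gives `1 ≤ h` and `log 5 ≤ h^β`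
  have hlog5 : 0 ≤ Real.log 5 := Real.log_nonneg (by norm_num)
  set h₀ : ℝ := max 1 ((Real.log 5) ^ (1 / β)) with hh₀def
  have hh₀1 : 1 ≤ h₀ := le_max_left _ _
  have hthr : ∀ hh : ℝ, h₀ ≤ hh → 1 ≤ hh ∧ Real.log 5 ≤ hh ^ β := by
    intro hh hle
    refine ⟨le_trans hh₀1 hle, ?_⟩
    have h1 : (Real.log 5) ^ (1 / β) ≤ hh := le_trans (le_max_right _ _) hle
    have h2 := Real.rpow_le_rpow (Real.rpow_nonneg hlog5 _) h1 hβ.le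
    rw [← Real.rpow_mul hlog5, show 1 / β * β = 1 by field_simp, Real.rpow_one] at h2
    exact h2
  set Kf : ℝ := max K₂ 0 + h₀ + 1 with hKfdef
  refine ⟨Real.exp Kf, Real.exp_pos Kf, fun a b c habc => ?_⟩
  have hr0 : (0 : ℝ) < ((rad a b c : ℕ) : ℝ) := by exact_mod_cast rad_pos_nat a b c
  have hr1 : (1 : ℝ) ≤ ((rad a b c : ℕ) : ℝ) := by exact_mod_cast rad_pos_nat a b c
  have hlogr : 0 ≤ Real.log ((rad a b c : ℕ) : ℝ) := Real.log_nonneg hr1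
  have hcR : (0 : ℝ) < c := by
    obtain ⟨ha, -, hsum, -⟩ := habc
    exact_mod_cast (show 0 < c by omega)
  have key : ∀ a' b' : ℕ, IsABCTriple a' b' c → a' ≤ b' → rad a' b' c = rad a b c → h₀ ≤ Real.log (c : ℝ) →
      Real.log (c : ℝ) ≤ (1 + ε) * Real.log ((rad a b c : ℕ) : ℝ) + K₂ := by
    intro a' b' h' hab' hrad' hle
    obtain ⟨h1, h5⟩ := hthr _ hle
    obtain ⟨N, hN1, hNle, hmain⟩ := shallowWindow_core hβ hε hε2 hW h' hab' h1 hβ1 h5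
    rw [hrad'] at hmain
    exact hK₂ _ _ _ (lt_of_lt_of_le one_pos h1) hlogr hN1 hNle hmain
  have hlog : Real.log (c : ℝ) < Kf + (1 + ε) * Real.log ((rad a b c : ℕ) : ℝ) := by
    have hK0 : (0 : ℝ) ≤ max K₂ 0 := le_max_right _ _
    rcases lt_or_ge (Real.log (c : ℝ)) h₀ with hlt | hle
    · rw [hKfdef]; nlinarith
    · have hK2 : K₂ ≤ max K₂ 0 := le_max_left _ _
      rcases le_total a b with hab | hba
      · have := key a b habc hab rfl hle
        rw [hKfdef]; linarith
      · have := key b a habc.swap hba (rad_swap a b c) hle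
        rw [hKfdef]; linarith
  calc (c : ℝ) = Real.exp (Real.log c) := (Real.exp_log hcR).symm
    _ < Real.exp (Kf + (1 + ε) * Real.log ((rad a b c : ℕ) : ℝ)) := Real.exp_lt_exp.mpr hlog
    _ = Real.exp Kf * ((rad a b c : ℕ) : ℝ) ^ (1 + ε) := by
        rw [Real.exp_add, Real.rpow_def_of_pos hr0, mul_comm (Real.log _)]
    _ ≤ Real.exp Kf * ((rad a b c : ℕ) : ℝ) ^ (1 + ε₀) := by
        apply mul_le_mul_of_nonneg_left _ (Real.exp_pos Kf).le
        exact Real.rpow_le_rpow_of_exponent_le hr1 (by linarith)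

/-- **Claim A at `λ = 1`.** abc with constants `e^(K/η)` (`log C(η) ≤ K/η`, the Robert–Stewart–Tenenbaum order of
growth) on a shallow window `{log(c/min) ≤ (log c)^β}` with `β > 1/2` implies `ABC` — whereas on the compactly
balanced cell (`β = 0`, the hypothesis `H` of the crux) no exponent `λ ≥ 0` qualifies. [folklore] -/
theorem abc_of_shallowWindow_linearConstants {β K : ℝ} (hβ2 : 1 / 2 < β) (hβ1 : β ≤ 1) (hK : 0 ≤ K)
    (hW : ∀ η : ℝ, 0 < η → η ≤ 1 → ∀ a b c : ℕ, IsABCTriple a b c →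
      Real.log (c : ℝ) - Real.log ((min a b : ℕ) : ℝ) ≤ (Real.log (c : ℝ)) ^ β →
        Real.log (c : ℝ) ≤ (1 + η) * Real.log ((rad a b c : ℕ) : ℝ) + K / η) :
    _root_.ABC := by
  refine abc_of_shallowWindow (lam := 1) (by linarith) hβ1 zero_le_one hK (by linarith) ?_
  intro η hη hη1 a b c habc hwin
  have h := hW η hη hη1 a b c habc hwin
  rwa [Real.rpow_neg_one, ← div_eq_mul_inv]

/-- **Registered sub-goal `shallowWindowTransfer` (closed form of `abc_of_shallowWindow`, census S5 Claim A).** [folklore] -/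
theorem shallowWindowTransfer : ∀ β lam K : ℝ, 0 < β → β ≤ 1 → 0 ≤ lam → 0 ≤ K → lam * (1 - β) < β →
    (∀ η : ℝ, 0 < η → η ≤ 1 → ∀ a b c : ℕ, IsABCTriple a b c →
      Real.log (c : ℝ) - Real.log ((min a b : ℕ) : ℝ) ≤ (Real.log (c : ℝ)) ^ β →
        Real.log (c : ℝ) ≤ (1 + η) * Real.log ((rad a b c : ℕ) : ℝ) + K * η ^ (-lam)) → _root_.ABC :=
  fun _ _ _ hβ hβ1 hlam hK hβl hW => abc_of_shallowWindow hβ hβ1 hlam hK hβl hW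

end Summit.ABC.ABC.Theorems.CompactBalanceTransfer.WindowTransfer
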